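import Summits.MatrixMultiplication.MatrixMultiplication.Theorems.FarEdgeDescentChord
import Summits.MatrixMultiplication.MatrixMultiplication.Theorems.FarEdgeDescentLogRate
import HarnessLib

/-!
# Route `FarEdgeDescent` — the special leaf as a TAMENESS statement, and the tame (polytope) world

Support module (def-free) for the aside `TameProfile` (stmt-MatrixMultiplication-31917, gen 11) and the
special crux `FiniteSaturation` (stmt-MatrixMultiplication-23739) of the route
`Summits/MatrixMultiplication/MatrixMultiplication/Theses/FarEdgeDescent.lean`.

Write `f(m) := ω(1,m,1)` for the exponent of `⟨n, n^m, n⟩` and `e(m) := f(m) − (m+1) ≥ 0` for the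
far-edge excess.  In Strassen's spectral picture `f` is the support function of the spectrum body
`Δ_MM ⊂ [0,1]³` along the line `(1,m,1)`, so `f` is convex and 1-Lipschitz; `Δ_MM` polyhedral near the
far edge would make `f` SEMILINEAR (a maximum of finitely many affine functions) — the «polytope /
one-dark-vertex worlds» of the route's docstrings.  This module proves, with no hypotheses on `ω`:

* §1 (pure real lemma) among finitely many affine functions one dominates all others for every large
  argument (`exists_eventual_dominator`).
* §2 **`FiniteSaturation ⟺ f is eventually affine`** (`finiteSaturation_iff_eventuallyAffine`): an
  eventually-affine profile squeezed between `m + 1` (information bound, tree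
  `add_one_le_omegaRect_one_mid_one`) and `m + 1 + log 2/log(2m+2)` (the landed `LogRate`,
  `FarEdgeDescentLogRate.logRate`, item 25370) has slope `1` (one padding step,
  `omegaRect_one_mid_one_le_add`) and intercept `1`; conversely a saturated integer shape saturates every
  larger real shape (`FarEdgeDescentChord.excess_antitone`).  So the special leaf is the constants-free
  statement «the far-edge profile has a LAST KINK».
* §3 the aside BY NAME: `TameProfile → FiniteSaturation` (`finiteSaturation_of_tameProfile`),
  `ω = 2 → TameProfile` (`tameProfile_of_mm`, one piece `m + 1`), hence the DICHOTOMY FORM of the node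
  `ω = 2 ⟺ TameProfile ∧ AnchoredLogConvexity` (`node_tame_iff`, through the route's deciding theorem
  `closes`: in a tame world the law decides the summit, and a tame world with `ω > 2` violates the law, `not_alc_of_tameProfile_of_not_mm`).  The cut of record
  stays `ω = 2 ⟺ FiniteSaturation ∧ AnchoredLogConvexity` (`FarEdgeDescentChord.node_iff`): `TameProfile` is
  STRONGER than `FiniteSaturation`, filed as an aside (world statement), not as a piece.

Placement [cite: arXiv:2604.01386, §8.1 Prop 8.1, Cor 8.4, p.47]: the zeroth-order edge rigidity
`γ₂(φ) = 1 ⟹ γ₁(φ) + γ₃(φ) = 1` for spectral points is a theorem over every field (Schönhage's identity),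
equivalent to `lim e(k) = 0` (Lotti–Romani); `FiniteSaturation` is its first-order (linear) stability on
`Δ_MM`, `e(k) = max_{Δ_MM} [(γ₁+γ₃−1) − k(1−γ₂)] = 0`.  [cite: LottiRomani1983, §2 (p. 174), Prop. 4.1]

Written by the decomp-mm lens-2 planner seat (gen 11); imports only BUILT modules.
-/

set_option linter.dupNamespace false

noncomputable section

namespace Summit.MatrixMultiplication.MatrixMultiplication.Theorems.FarEdgeDescentTameProfile

open Literature.Computability.AlgebraicComplexity
open Summit.MatrixMultiplication.MatrixMultiplication.Theses.FarEdgeDescent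
open Summit.MatrixMultiplication.MatrixMultiplication.Theorems.FarEdgeDescentChord

/-! ## §1 Finite maxima of affine functions are eventually attained by one of them -/

/-- Among finitely many affine functions `m ↦ α i · m + β i` one dominates all the others for every
large `m` (largest slope, then largest intercept; Lean's `x / 0 = 0` makes the equal-slope thresholds
harmless). -/
theorem exists_eventual_dominator {N : ℕ} (α β : Fin (N + 1) → ℝ) :
    ∃ i₀ : Fin (N + 1), ∃ M : ℝ, ∀ m : ℝ, M ≤ m → ∀ j, α j * m + β j ≤ α i₀ * m + β i₀ := by
  classical
  obtain ⟨i₁, -, hi₁⟩ :=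
    Finset.exists_max_image Finset.univ α (Finset.univ_nonempty (α := Fin (N + 1)))
  set S : Finset (Fin (N + 1)) := Finset.univ.filter fun j => α j = α i₁ with hS
  have hSne : S.Nonempty := ⟨i₁, by simp [hS]⟩
  obtain ⟨i₀, hi₀S, hi₀⟩ := Finset.exists_max_image S β hSne
  have hαi₀ : α i₀ = α i₁ := by simpa [hS] using hi₀S
  refine ⟨i₀, Finset.univ.sup' Finset.univ_nonempty (fun j => (β j - β i₀) / (α i₀ - α j)), ?_⟩
  intro m hm j
  have hjle : α j ≤ α i₀ := hαi₀ ▸ hi₁ j (Finset.mem_univ j)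
  have hjM : (β j - β i₀) / (α i₀ - α j) ≤ m :=
    le_trans (Finset.le_sup' (fun j => (β j - β i₀) / (α i₀ - α j)) (Finset.mem_univ j)) hm
  rcases hjle.lt_or_eq with hlt | heq
  · have hpos : 0 < α i₀ - α j := sub_pos.mpr hlt
    have h1 : β j - β i₀ ≤ m * (α i₀ - α j) := (div_le_iff₀ hpos).1 hjM
    nlinarith
  · have hjS : j ∈ S := by simp [hS, heq, hαi₀]
    have hβ : β j ≤ β i₀ := hi₀ j hjS
    rw [heq]
    linarith

/-! ## §2 Eventual affinity of the far-edge profile ⟺ `FiniteSaturation` -/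

/-- `e(k) → 0` in usable form: for every `ε > 0` and every bound `B` some INTEGER shape `k ≥ B`, `k ≥ 1`,
has `ω(1,k,1) − (k+1) < ε` (from the landed `LogRate`, item 25370: choose `2k + 2 > exp(log 2/ε)`). -/
theorem exists_nat_excess_lt {ε : ℝ} (hε : 0 < ε) (B : ℝ) :
    ∃ k : ℕ, B ≤ k ∧ 1 ≤ k ∧ omegaRect ℂ 1 k 1 - (k + 1) < ε := by
  obtain ⟨k, hk⟩ := exists_nat_gt (max (max B 1) (Real.exp (Real.log 2 / ε)))
  have hkB : B ≤ k := le_trans (le_trans (le_max_left _ _) (le_max_left _ _)) hk.le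
  have hk1 : (1 : ℝ) ≤ k := le_trans (le_trans (le_max_right _ _) (le_max_left _ _)) hk.le
  have hk1n : 1 ≤ k := by exact_mod_cast hk1
  have hexp : Real.exp (Real.log 2 / ε) < 2 * k + 2 := by
    have := le_trans (le_max_right _ _) hk.le
    linarith
  have hpos : 0 < Real.log (2 * (k : ℝ) + 2) := Real.log_pos (by linarith)
  have hlt : Real.log 2 / ε < Real.log (2 * (k : ℝ) + 2) := by
    have h := Real.log_lt_log (Real.exp_pos _) hexp
    rwa [Real.log_exp] at h
  have hquot : Real.log 2 / Real.log (2 * (k : ℝ) + 2) < ε := by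
    rw [div_lt_iff₀ hpos]
    have h2 : Real.log 2 < ε * Real.log (2 * (k : ℝ) + 2) := by
      have := (div_lt_iff₀ hε).1 hlt
      linarith [this]
    linarith
  refine ⟨k, hkB, hk1n, ?_⟩
  have hL := FarEdgeDescentLogRate.logRate k hk1n
  linarith

/-- **Eventual affinity ⟹ `FiniteSaturation`.**  If `ω(1,m,1) = α m + β` for all real `m ≥ M`, then
`α = 1` (one padding step gives `α ≤ 1`, the information bound `m + 1 ≤ ω(1,m,1)` gives `α ≥ 1`) and
`β = 1` (`β ≥ 1` by the information bound, `β ≤ 1` by `LogRate`), so every shape `≥ M` is saturated. -/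
theorem finiteSaturation_of_eventuallyAffine
    (h : ∃ M α β : ℝ, ∀ m : ℝ, M ≤ m → omegaRect ℂ 1 m 1 = α * m + β) : FiniteSaturation := by
  obtain ⟨M, α, β, hf⟩ := h
  set M₁ : ℝ := max M 1 with hM₁
  have hM₁M : M ≤ M₁ := le_max_left _ _
  have hM₁1 : 1 ≤ M₁ := le_max_right _ _
  -- slope ≤ 1 : one padding step from M₁ to M₁ + 1
  have hα_le : α ≤ 1 := by
    have h1 := hf M₁ hM₁M
    have h2 := hf (M₁ + 1) (by linarith)
    have hp := omegaRect_one_mid_one_le_add ℂ (p := M₁ + 1) (q := M₁) (by linarith)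
    rw [h1, h2] at hp
    linarith
  -- slope ≥ 1 : growth against the information bound m + 1 ≤ ω(1,m,1)
  have hα_ge : 1 ≤ α := by
    by_contra hlt
    have hlt' : α < 1 := lt_of_not_ge hlt
    set m : ℝ := max M₁ ((β - 1) / (1 - α) + 1) with hm
    have hmM : M ≤ m := le_trans hM₁M (le_max_left _ _)
    have hlow := add_one_le_omegaRect_one_mid_one ℂ m
    rw [hf m hmM] at hlow
    have hpos : 0 < 1 - α := by linarith
    have hm2 : (β - 1) / (1 - α) + 1 ≤ m := le_max_right _ _
    have hm3 : β - 1 + (1 - α) ≤ (1 - α) * m := by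
      have := mul_le_mul_of_nonneg_left hm2 hpos.le
      rw [mul_add, mul_div_cancel₀ _ hpos.ne', mul_one] at this
      linarith
    nlinarith
  have hα : α = 1 := le_antisymm hα_le hα_ge
  -- intercept = 1 : β ≥ 1 from the information bound, β ≤ 1 from LogRate
  have hβ_ge : 1 ≤ β := by
    have hlow := add_one_le_omegaRect_one_mid_one ℂ M₁
    rw [hf M₁ hM₁M, hα] at hlow
    linarith
  have hβ_le : β ≤ 1 := by
    by_contra hlt
    have hlt' : 1 < β := lt_of_not_ge hlt
    obtain ⟨k, hkB, -, hk⟩ := exists_nat_excess_lt (ε := β - 1) (by linarith) M₁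
    rw [hf k (le_trans hM₁M hkB), hα] at hk
    linarith
  have hβ : β = 1 := le_antisymm hβ_le hβ_ge
  -- a saturated real shape M₁ + 1 > 1, then the tree's real ⟹ integer transfer
  rw [finiteSaturation_iff_realSaturation]
  refine ⟨M₁ + 1, by linarith, ?_⟩
  rw [hf (M₁ + 1) (by linarith), hα, hβ]
  ring

/-- **`FiniteSaturation` ⟹ eventual affinity** (`e` antitone and nonnegative: an integer zero at `k` is a
zero at every real `m ≥ k`, where the profile is `1·m + 1`). -/
theorem eventuallyAffine_of_finiteSaturation (h : FiniteSaturation) :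
    ∃ M α β : ℝ, ∀ m : ℝ, M ≤ m → omegaRect ℂ 1 m 1 = α * m + β := by
  obtain ⟨k, -, hk⟩ := h
  refine ⟨k, 1, 1, fun m hm => ?_⟩
  have h1 := excess_antitone (x := m) (y := (k : ℝ)) hm
  have h0 := add_one_le_omegaRect_one_mid_one ℂ m
  rw [hk] at h1
  linarith

/-- **The special leaf is a tameness statement with no constants**:
`FiniteSaturation ⟺ ∃ M α β, ∀ m ≥ M, ω(1,m,1) = α·m + β`. -/
theorem finiteSaturation_iff_eventuallyAffine :
    FiniteSaturation ↔ ∃ M α β : ℝ, ∀ m : ℝ, M ≤ m → omegaRect ℂ 1 m 1 = α * m + β :=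
  ⟨eventuallyAffine_of_finiteSaturation, finiteSaturation_of_eventuallyAffine⟩

/-! ## §3 The aside `TameProfile` (stmt-MatrixMultiplication-31917) by name -/

/-- A semilinear profile is eventually affine (§1 applied to the pieces of `TameProfile`). -/
theorem eventuallyAffine_of_tameProfile (h : TameProfile) :
    ∃ M α β : ℝ, ∀ m : ℝ, M ≤ m → omegaRect ℂ 1 m 1 = α * m + β := by
  obtain ⟨N, α, β, hT⟩ := h
  obtain ⟨i₀, M, hdom⟩ := exists_eventual_dominator α β
  refine ⟨max M 1, α i₀, β i₀, fun m hm => ?_⟩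
  have hm1 : 1 ≤ m := le_trans (le_max_right _ _) hm
  have hmM : M ≤ m := le_trans (le_max_left _ _) hm
  obtain ⟨⟨j, hj⟩, hub⟩ := hT m hm1
  apply le_antisymm
  · rw [← hj]
    exact hdom m hmM j
  · exact hub ⟨i₀, rfl⟩

/-- **EDGE (aside ⟹ special crux): `TameProfile → FiniteSaturation`.** -/
theorem finiteSaturation_of_tameProfile (h : TameProfile) : FiniteSaturation :=
  finiteSaturation_of_eventuallyAffine (eventuallyAffine_of_tameProfile h)

/-- **NECESSITY: `ω = 2 → TameProfile`** (the single affine piece `m + 1` on `[1, ∞)`, Huang–Pan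
saturation `FarEdgeDescentChord.saturated_of_omega_eq_two`). -/
theorem tameProfile_of_mm (h : _root_.MatrixMultiplication) : TameProfile := by
  rw [_root_.MatrixMultiplication_iff] at h
  refine ⟨0, fun _ => 1, fun _ => 1, fun m hm => ?_⟩
  rw [saturated_of_omega_eq_two h hm]
  constructor
  · exact ⟨0, by ring⟩
  · rintro _ ⟨i, rfl⟩
    linarith

/-- **DICHOTOMY FORM of the node**: `ω(ℂ) = 2 ⟺ TameProfile ∧ AnchoredLogConvexity` — tameness of the
far-edge profile (a polytope-world property) AND the anchored log-convexity law (a round-world property);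
`ω = 2` is exactly both.  (The cut of record keeps the weaker special piece: `FarEdgeDescentChord.node_iff`.) -/
theorem node_tame_iff : _root_.MatrixMultiplication ↔ TameProfile ∧ AnchoredLogConvexity :=
  ⟨fun h => ⟨tameProfile_of_mm h, anchoredLogConvexity_of_mm h⟩,
    fun h => closes (finiteSaturation_of_tameProfile h.1) h.2⟩

/-- … contrapositively: a tame world with `ω > 2` violates the law (the «polytope / one-dark-vertex
world» of the docstring of `AnchoredLogConvexity`, now a kernel statement). -/
theorem not_alc_of_tameProfile_of_not_mm (hT : TameProfile) (hS : ¬ _root_.MatrixMultiplication) :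
    ¬ AnchoredLogConvexity :=
  fun hA => hS (closes (finiteSaturation_of_tameProfile hT) hA)

/-- `TameProfile` is at least as strong as the special leaf and at most as strong as the summit:
`(ω = 2 → TameProfile) ∧ (TameProfile → FiniteSaturation)` — its place on the special side. -/
theorem tameProfile_sandwich :
    (_root_.MatrixMultiplication → TameProfile) ∧ (TameProfile → FiniteSaturation) :=
  ⟨tameProfile_of_mm, finiteSaturation_of_tameProfile⟩

end Summit.MatrixMultiplication.MatrixMultiplication.Theorems.FarEdgeDescentTameProfile

end
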